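import Literature.MathematicalPhysics.QuantumFieldTheory.King1986.CovarianceRate
import Literature.MathematicalPhysics.QuantumFieldTheory.Balaban1983to89.T4EtaRateMin

/-!
# T⁴ programme, spine node NE2 (U1a) — THE KING TRANSPLANT, unit layer:
# `C^{(k)}(U)`-rate ⇐ (H1) uniform coercivity ∧ (H2) uniform decay ∧ (H3) effective-operator rate ∧ (H4) volume sum,
# and (H3) ⇐ coefficient rate ∧ block rate (King (2.14) shape) — leaves TYPED, assembly KERNEL-CHECKED

Cell `pub-balaban`, unit `b2b-balaban-t4-ne2-p3` (ROUND-2 technique-distinct prover #3 on BINDER row NE2; assigned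
technique «LITERATURE TRANSPLANT»: take the nearest PRINTED linear block-spin η-rate statement and write its transplant to
Bałaban's vector / background layers with the exact gap named).  Companion record: `t4/skeletons/NE2-t4-ne2-p3.md`.

THE PRINTED STATEMENT TRANSPLANTED HERE.  C. King, *The U(1) Higgs model. I. The continuum limit*, Commun. Math. Phys.
**102** (1986) 649–677 [King1986], Lemma 4.5 (4.38) p. 674: *"|C^{(k)}(x, y) − C^{(k+n)}(x, y)| ≤ CL^{−k}e^{−δ₀|x−y|}"*
for the unit-lattice fluctuation covariance `C^{(k)} = (Δ^{(k)} + aL⁻²Q*Q)⁻¹` ((2.16) p. 653), proved pp. 674–675 from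
(i) the coercivity (4.33), (ii) the decay (4.34), (iii) Lemma 4.3 (4.18) (the rate of the effective Laplacians
`Δ^{(k+n)} − Δ^{(k)}`) by the resolvent interpolation (4.32), (4.39)–(4.41); and the shape (2.14) p. 653
`Δ^{(k)} = a_k(L^kε)⁻²I − a_k²(L^kε)⁻⁴Q_kG_kQ_k*` through which (iii) descends to the block `Q_kG_kQ_k*` of the fine
propagator (Prop. 3.10 (3.91) p. 669, Lemma 4.1 (4.9) p. 671 for `a_k`).  King's statements are scalar and at
`A = 0` (p. 670 *"and A = 0, of course"*; p. 653 *"All the corresponding expressions for the vector field are obtained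
from (2.13)–(2.17) by setting m² = μ₀², N = d and A = 0"*).  The kernel form of Lemma 4.5 over an ARBITRARY finite
index set is the tree's `King1986.lemma45` / `lemma45_of_supRate` (`King1986/CovarianceRate`, template lineage): the
background and the vector structure enter ONLY through its hypotheses.  THIS FILE turns those hypotheses into NAMED
LEAVES for a whole tower `k ↦ D k` of unit-lattice effective operators (at a background: `D k = Δ^{(k)}(U^{(k)})`, all on
the SAME unit lattice `n`), proves the assembly for the tower with a geometric one-step rate, puts the conclusion in the
cell's typed currency `T4EtaRateMin.LocalRate`, and proves the one honest reduction of the rate leaf (H3) one layer down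
(King's (2.14) shape: coefficient rate + block rate ⟹ effective-operator rate).

WHAT IS A LEAF HERE AND WHY NONE IS NE2 IN DISGUISE.  (H1) `UniformCoercive`, (H2) `UniformCTBound` /
`UniformKernelDecay`, (H4) `VolumeSum` are ONE-RUN, k-UNIFORM bounds — the printed KIND of input ([Balaban1985Background
Propagators] Thm 3.15 (3.187) p. 432, [Balaban1984PropagatorsI] (1.67) p. 29 / [Balaban1984PropagatorsII] (2.157) p. 250)
— no difference of two spacings occurs in them.  (H3) `EffectiveOperatorSupRate` IS a two-spacing statement, one layer
BELOW the root (effective operators, not covariances): at `U = 1` it is a THEOREM of the tree for Bałaban's (1.66)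
(`Balaban1983to89.B5ActionRate166`, `…T4Rate166StripDirect.W166_rate`, lineages t4-ne2-p1 and t4-ne2-p2); at `U ≠ 1` it is reduced
here (`effectiveOperatorSupRate_of_block`) to the rate of the KING-AVERAGED BLOCK `Q_kG_k(U_k)Q_k*` — exactly the object of
the row owner's resolvent route (`Summit.…T4Continuum.CovariantAveragingTower.TowerLimitRate`,
`…Spine.NE2PerturbedLayer.towerLimitRate_perturbed_king`, lineage t4-ne2-p1), which this file therefore sits ONE LAYER
ABOVE and composes with by name (operator norm ⟹ entrywise sup: `|M z w| ≤ ‖M‖`, one line, owed as a bridge lemma).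

HONEST FRAMING (T4-DAG p. 1).  Finite index sets (one fixed unit torus), linear (Gaussian) layer, entrywise currency with
position-space decay; every statement below is OUR bookkeeping ([folklore] algebra around a printed mechanism), NOT a
quotation and NOT an estimate on Bałaban's actual operators: no carrier of [B9]'s `C^{(k)}(Λ; U)` is constructed here, no
`def … : Prop` is used as a hypothesis of anything but the displayed assembly theorems, nothing printed is asserted.
NOT infinite volume, NOT a mass gap, NOT the Clay problem, NOT summit progress; spine 0/9 unchanged.
HONEST DEPENDENCY: continuum YM on T⁴ ⇐ BetaPertH ∧ nine spine estimates (0/9 proved); BetaPertH ⇐ (D1) ∧ (D4) ∧ CAP+tail;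
G-an2-4 gates asym, D1 and NE2/3/4.
-/

noncomputable section

open Matrix Finset Real Filter Topology
open Literature.MathematicalPhysics.QuantumFieldTheory.Balaban1983to89.QGQInverse (Coercive)
open Literature.MathematicalPhysics.QuantumFieldTheory.King1986 (wRow wCol lemma45_of_supRate)
open Literature.MathematicalPhysics.QuantumFieldTheory.Balaban1983to89.T4EtaRateMin (Readings LocalRate)

namespace Summit.QuantumFields.BalabanUV.T4Continuum.NE2KingTransplant

variable {n : Type*} [Fintype n] [DecidableEq n]

/-- The three pseudo-metric axioms King's `|x − y|` on the unit torus satisfies (and all that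
`King1986.lemma45` uses of it). [folklore] -/
structure IsPseudoMetric (d : n → n → ℝ) : Prop where
  symm : ∀ i j, d i j = d j i
  zero : ∀ i, d i i = 0
  tri : ∀ i j k, d i k ≤ d i j + d j k

omit [Fintype n] [DecidableEq n] in
/-- a pseudo-metric is nonnegative. [folklore] -/
theorem IsPseudoMetric.nonneg {d : n → n → ℝ} (hd : IsPseudoMetric d) (i j : n) : 0 ≤ d i j := by
  have h := hd.tri i j i
  rw [hd.zero i, hd.symm j i] at h
  linarith

/-! ## §1 The leaves of the unit layer (King's (4.33), (4.34), Lemma 4.3, volume sum) for a TOWER `k ↦ D k` -/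

section leaves

variable (D : ℕ → Matrix n n ℝ) (B : Matrix n n ℝ) (d : n → n → ℝ)

/-- **Leaf (H1) — uniform endpoint coercivity**, King (4.33) p. 674 *"C_Ω^{(k)}(s)⁻¹ ≥ γ₀I"* at every level:
`D k + B ≥ γ`.  Transplant status (record §2): scalar `A = 0` PRINTED+KERNEL (`King1986.Torus.king433`); Bałaban vector
`U = 1`: FAILS as printed for `Δ_k` alone ((1.67): `≥ γ₀‖∂₁B‖²` only — gauge modes), FIXED on the constrained subspace by
(2.157) (`T4Cov2156Rate`, kernel); background: (H1)(1) + Lipschitz-in-`U` smallness (one line). A ONE-RUN bound, no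
spacing difference. [folklore] -/
def UniformCoercive (γ : ℝ) : Prop :=
  ∀ k, Coercive (D k + B) γ

/-- **Leaf (H2) — uniform Combes–Thomas summability**, King (4.34) p. 674 *"|C_Ω^{(k)}(s)⁻¹(x, y)| ≤ C exp[−δ₀|x−y|]"*
in the summable form `King1986.covOp_decay` consumes: weighted off-diagonal row/column sums of every `D k` (`≤ ρ`) and
of `B` (`≤ ρ_B`).  Transplant status: the printed KIND of input at every layer ([B9] Thm 3.15 (3.187), η-uniform —
under audit, hypothesis structure). ONE-RUN, k-uniform. [folklore] -/
def UniformCTBound (κ ρ ρB : ℝ) : Prop :=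
  (∀ k i, wRow (D k) d κ i ≤ ρ) ∧ (∀ k j, wCol (D k) d κ j ≤ ρ) ∧
    (∀ i, wRow B d κ i ≤ ρB) ∧ (∀ j, wCol B d κ j ≤ ρB)

/-- **Leaf (H2′) — uniform pointwise decay of the effective operators** (King's Theorem 3.3 (3.6) p. 656 for
`Δ^{(k)}`, used on p. 675 in *"Combining Lemma 4.3 and the uniform exponential decay of Δ^{(k)} …"*): the input of the
`min ≤ geometric mean` step `King1986.sub_kernel_rate` that converts a SUP rate into a position-space rate at half the
decay. ONE-RUN, k-uniform. [folklore] -/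
def UniformKernelDecay (C₁ κ : ℝ) : Prop :=
  ∀ k z w, |D k z w| ≤ C₁ * Real.exp (-(2 * κ * d z w))

/-- **Leaf (H3) — the one-step SUP-NORM rate of the effective operators, geometric in `k`**: King's Lemma 4.3 (4.18)
p. 672 read through (4.35) as a sup bound `CL^{−2k}` on the kernel of `Δ^{(k+1)} − Δ^{(k)}` (here `ε·r^k`).  THE ONLY
TWO-SPACING LEAF; it lives one layer BELOW the root (operators, not covariances) and is itself reduced in §3.
Transplant status: scalar PRINTED+KERNEL (`King1986.lemma43_aK`, `prop310_rate`); Bałaban (1.66) at `U = 1` KERNEL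
(`B5ActionRate166`, `T4Rate166StripDirect`); `U ≠ 1` = §3 + the row owner's `TowerLimitRate` object. [folklore] -/
def EffectiveOperatorSupRate (ε r : ℝ) : Prop :=
  ∀ k z w, |(D (k + 1) - D k) z w| ≤ ε * r ^ k

/-- **Leaf (H4) — the volume-independent sum** `Σ_z e^{−(κ/2)d(x,z)} ≤ V` (King (4.41): *"Σ_{z,w∈Ω} exp[…] ≤ C…"*).
[folklore] -/
def VolumeSum (κ V : ℝ) : Prop :=
  ∀ x, ∑ z, Real.exp (-(κ / 2 * d x z)) ≤ V

/-- **ROOT of the unit layer — King's (4.38) for the whole tower with a geometric one-step rate**: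
`|(D k + B)⁻¹(x,y) − (D (k+1) + B)⁻¹(x,y)| ≤ C·s^k·e^{−κ′d(x,y)}` for all `k, x, y`.  For Bałaban this is the shape of
the cell's `T4EtaRate.EtaRateIneqUnit` / `NE2PlusUnit` (one-step form; the `n`-step form follows by the geometric sum,
`T4EtaRateMin.LocalRate.multiStep`). [folklore] -/
def CovarianceTowerRate (C κ' s : ℝ) : Prop :=
  ∀ k x y, |(D k + B)⁻¹ x y - (D (k + 1) + B)⁻¹ x y| ≤ C * s ^ k * Real.exp (-(κ' * d x y))

end leaves

/-! ## §2 The assembly: (H1) ∧ (H2) ∧ (H2′) ∧ (H3) ∧ (H4) ⟹ ROOT, by `King1986.lemma45_of_supRate` at every level -/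

/-- **THE UNIT-LAYER ASSEMBLY (kernel-checked).**  For a tower of unit-lattice effective operators `D k` and a fixed
`B` on a finite index set with pseudo-metric `d`: uniform coercivity `γ`, uniform Combes–Thomas bounds `ρ, ρ_B` with
`ρ + ρ_B < γ`, uniform decay `C₁e^{−2κd}`, the one-step sup rate `ε·r^k` of `D (k+1) − D k` and the volume sum `V` give
King's (4.38) at every level with rate `(√r)^k`, constant `√(2C₁ε)(γ − ρ − ρ_B)⁻²V²` and decay `κ/2` — i.e. King's own
bookkeeping *"Combining Lemma 4.3 and the uniform exponential decay … gives |(4.40)| ≤ CL^{−k}…"* (p. 675; `L^{−2k}` sup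
rate ↦ `L^{−k}`: `r = L⁻²`, `√r = L⁻¹`).  Proof = `King1986.lemma45_of_supRate` applied at each `k`. [folklore] -/
theorem covarianceTowerRate_of_leaves (D : ℕ → Matrix n n ℝ) (B : Matrix n n ℝ) (d : n → n → ℝ)
    {γ κ ρ ρB ε C₁ V r : ℝ} (hd : IsPseudoMetric d) (hγ : ρ + ρB < γ) (hκ : 0 ≤ κ) (hε : 0 ≤ ε) (hr : 0 ≤ r)
    (h1 : UniformCoercive D B γ) (h2 : UniformCTBound D B d κ ρ ρB) (h2' : UniformKernelDecay D d C₁ κ)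
    (h3 : EffectiveOperatorSupRate D ε r) (h4 : VolumeSum d κ V) :
    CovarianceTowerRate D B d (Real.sqrt (ε * (2 * C₁)) * ((γ - (ρ + ρB))⁻¹) ^ 2 * V ^ 2) (κ / 2)
      (Real.sqrt r) := by
  unfold CovarianceTowerRate
  intro k x y
  obtain ⟨hr1, hc1, hrB, hcB⟩ := h2
  have key := lemma45_of_supRate (D k) (D (k + 1)) B d hγ hκ (mul_nonneg hε (pow_nonneg hr k))
    (h1 k) (h1 (k + 1)) hd.symm hd.zero hd.tri (hr1 k) (hr1 (k + 1)) hrB (hc1 k) (hc1 (k + 1)) hcB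
    (fun z w => h3 k z w) (h2' k) (h2' (k + 1)) h4 x y
  have hsq : Real.sqrt (r ^ k) = Real.sqrt r ^ k := by
    have h0 : 0 ≤ Real.sqrt r ^ k := pow_nonneg (Real.sqrt_nonneg r) k
    have e : r ^ k = (Real.sqrt r ^ k) ^ 2 := by
      rw [← pow_mul, mul_comm, pow_mul, Real.sq_sqrt hr]
    rw [e, Real.sqrt_sq h0]
  have hs : Real.sqrt (ε * r ^ k * (2 * C₁)) = Real.sqrt (ε * (2 * C₁)) * Real.sqrt r ^ k := by
    rw [show ε * r ^ k * (2 * C₁) = (ε * (2 * C₁)) * r ^ k by ring, Real.sqrt_mul' _ (pow_nonneg hr k), hsq]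
  calc |(D k + B)⁻¹ x y - (D (k + 1) + B)⁻¹ x y|
      ≤ Real.sqrt (ε * r ^ k * (2 * C₁)) * ((γ - (ρ + ρB))⁻¹) ^ 2 * V ^ 2 * Real.exp (-(κ / 2 * d x y)) := key
    _ = Real.sqrt (ε * (2 * C₁)) * ((γ - (ρ + ρB))⁻¹) ^ 2 * V ^ 2 * Real.sqrt r ^ k
          * Real.exp (-(κ / 2 * d x y)) := by rw [hs]; ring

/-! ## §2b The root in the cell's typed currency `T4EtaRateMin.LocalRate` (and the entrywise limit) -/

/-- The readings `k ↦ (D k + B)⁻¹(x, y)` of the tower, indexed by the pair `(x, y)` (one admissible datum: the index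
set `Unit`; no scalar reading). [folklore] -/
def covTowerReadings (D : ℕ → Matrix n n ℝ) (B : Matrix n n ℝ) : Readings Unit (n × n) where
  dom := Set.univ
  act := fun _ _ => 0
  loc := fun k _ p => (D k + B)⁻¹ p.1 p.2
  vol := 1
  vol_nonneg := zero_le_one

/-- **ROOT ⟹ the cell's `LocalRate` shape** (drop the decay factor `≤ 1`): the typed currency of node U1a/U1b
(`T4EtaRateMin.LocalRate`, the shape `T4Cov2156Rate.cov2156_localRate` instantiates at `U = 1`). [folklore] -/
theorem localRate_of_covarianceTowerRate {D : ℕ → Matrix n n ℝ} {B : Matrix n n ℝ}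
    {d : n → n → ℝ} {C κ' s : ℝ} (hC : 0 ≤ C) (hs : 0 ≤ s) (hκ' : 0 ≤ κ') (hd : ∀ x y, 0 ≤ d x y)
    (h : CovarianceTowerRate D B d C κ' s) : LocalRate (covTowerReadings D B) C s := by
  intro k _ _ p
  show |(D (k + 1) + B)⁻¹ p.1 p.2 - (D k + B)⁻¹ p.1 p.2| ≤ C * s ^ k
  have h0 := h k p.1 p.2
  rw [abs_sub_comm] at h0
  refine h0.trans ?_
  have hexp : Real.exp (-(κ' * d p.1 p.2)) ≤ 1 :=
    Real.exp_le_one_iff.mpr (by nlinarith [hd p.1 p.2])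
  calc C * s ^ k * Real.exp (-(κ' * d p.1 p.2)) ≤ C * s ^ k * 1 :=
        mul_le_mul_of_nonneg_left hexp (mul_nonneg hC (pow_nonneg hs k))
    _ = C * s ^ k := mul_one _

/-- **King's use of (4.38)**: with `s < 1` every entry `(D k + B)⁻¹(x, y)` converges as `k → ∞`
(`T4EtaRateMin.LocalRate.exists_limit`). [folklore] -/
theorem covariance_entry_limit {D : ℕ → Matrix n n ℝ} {B : Matrix n n ℝ} {d : n → n → ℝ} {C κ' s : ℝ}
    (hC : 0 ≤ C) (hs : 0 ≤ s) (hs1 : s < 1) (hκ' : 0 ≤ κ') (hd : ∀ x y, 0 ≤ d x y)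
    (h : CovarianceTowerRate D B d C κ' s) (x y : n) :
    ∃ ℓ : ℝ, Tendsto (fun k => (D k + B)⁻¹ x y) atTop (𝓝 ℓ) ∧ ∀ k, |(D k + B)⁻¹ x y - ℓ| ≤ C * s ^ k / (1 - s) := by
  obtain ⟨ℓ, h1, h2⟩ :=
    (localRate_of_covarianceTowerRate hC hs hκ' hd h).exists_limit hs1 (V := ()) (Set.mem_univ _) (x, y)
  exact ⟨ℓ, h1, h2⟩

/-! ## §3 One layer down: King's (2.14) shape `Δ^{(k)} = a_kI − a_k²·(Q_kG_kQ_k*)` — (H3) ⇐ coefficient rate ∧ block rate -/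

section effective

variable (a : ℕ → ℝ) (W : ℕ → Matrix n n ℝ)

/-- **King's (2.14) shape** p. 653, *"Δ^{(k),L^kε}(Ω, A) = a_k(L^kε)^{−2}I − a_k²(L^kε)^{−4}Q_k(A)G_k^ε(Ω, A)Q_k(A)*"*,
on the unit lattice: `effOp a W k = a_k·I − a_k²·W_k` with `W_k` the King-averaged block of the level-`k` fine
propagator (for Bałaban: (1.66)/(1.99) of [B5], `W_k = Q_kG_k(U_k)Q_k*`, up to the exact form certified in
`B5QGQ199Rate`; the row owner's `avgTow` object). [folklore] -/
def effOp (k : ℕ) : Matrix n n ℝ := a k • (1 : Matrix n n ℝ) - (a k) ^ 2 • W k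

omit [Fintype n] in
/-- the one-step difference of (2.14)-shaped operators, split into coefficient part and block part. [folklore] -/
theorem effOp_succ_sub (k : ℕ) :
    effOp a W (k + 1) - effOp a W k
      = (a (k + 1) - a k) • (1 : Matrix n n ℝ) - ((a (k + 1)) ^ 2 - (a k) ^ 2) • W (k + 1)
        - (a k) ^ 2 • (W (k + 1) - W k) := by
  simp only [effOp, sub_smul, smul_sub]
  abel

omit [Fintype n] in
/-- **(H3) ONE LAYER DOWN (kernel-checked).**  A geometric rate `θ_a r^k` of the coefficients `a_k` (King Lemma 4.1
(4.9) p. 671: `a_k = a(1 − L⁻²)(1 − L^{−2k})⁻¹`, explicit), a bound `|a_k| ≤ ā`, a one-step SUP rate `θ_W r^k` of the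
blocks `W_k` and a bound `|W_k(z,w)| ≤ C_W` give the sup rate of the effective operators with the explicit constant
`θ_a + 2āθ_aC_W + ā²θ_W`.  The block rate is the ONLY two-spacing input left: at `U = 1` a tree theorem (lineages
t4-ne2-p1 and t4-ne2-p2), at `U ≠ 1` the object of the row owner's `TowerLimitRate` (entrywise ⟸ operator norm). [folklore] -/
theorem effectiveOperatorSupRate_of_block {θa abar θW CW r : ℝ}
    (ha : ∀ k, |a (k + 1) - a k| ≤ θa * r ^ k) (hab : ∀ k, |a k| ≤ abar)
    (hW : ∀ k z w, |(W (k + 1) - W k) z w| ≤ θW * r ^ k) (hWb : ∀ k z w, |W k z w| ≤ CW) :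
    EffectiveOperatorSupRate (effOp a W) (θa + 2 * abar * θa * CW + abar ^ 2 * θW) r := by
  intro k z w
  rw [effOp_succ_sub]
  simp only [Matrix.sub_apply, Matrix.smul_apply, smul_eq_mul]
  have habar : 0 ≤ abar := (abs_nonneg _).trans (hab 0)
  have hθr : 0 ≤ θa * r ^ k := (abs_nonneg _).trans (ha k)
  have hCW : 0 ≤ CW := (abs_nonneg _).trans (hWb 0 z w)
  have h1 : |(a (k + 1) - a k) * (1 : Matrix n n ℝ) z w| ≤ θa * r ^ k := by
    rw [abs_mul]
    have hone : |(1 : Matrix n n ℝ) z w| ≤ 1 := by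
      rw [Matrix.one_apply]; split_ifs <;> simp
    calc |a (k + 1) - a k| * |(1 : Matrix n n ℝ) z w| ≤ θa * r ^ k * 1 :=
          mul_le_mul (ha k) hone (abs_nonneg _) hθr
      _ = θa * r ^ k := mul_one _
  have h2 : |((a (k + 1)) ^ 2 - (a k) ^ 2) * W (k + 1) z w| ≤ 2 * abar * θa * CW * r ^ k := by
    rw [abs_mul]
    have hsq : |(a (k + 1)) ^ 2 - (a k) ^ 2| ≤ 2 * abar * (θa * r ^ k) := by
      rw [sq_sub_sq, abs_mul]
      calc |a (k + 1) + a k| * |a (k + 1) - a k| ≤ (abar + abar) * (θa * r ^ k) :=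
            mul_le_mul ((abs_add_le _ _).trans (add_le_add (hab _) (hab _))) (ha k) (abs_nonneg _)
              (by linarith)
        _ = 2 * abar * (θa * r ^ k) := by ring
    calc |(a (k + 1)) ^ 2 - (a k) ^ 2| * |W (k + 1) z w| ≤ 2 * abar * (θa * r ^ k) * CW :=
          mul_le_mul hsq (hWb _ z w) (abs_nonneg _) (by positivity)
      _ = 2 * abar * θa * CW * r ^ k := by ring
  have hW' : |W (k + 1) z w - W k z w| ≤ θW * r ^ k := by
    simpa only [Matrix.sub_apply] using hW k z w
  have h3 : |(a k) ^ 2 * (W (k + 1) z w - W k z w)| ≤ abar ^ 2 * θW * r ^ k := by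
    rw [abs_mul, abs_pow]
    calc |a k| ^ 2 * |W (k + 1) z w - W k z w| ≤ abar ^ 2 * (θW * r ^ k) :=
          mul_le_mul (pow_le_pow_left₀ (abs_nonneg _) (hab k) 2) hW' (abs_nonneg _) (by positivity)
      _ = abar ^ 2 * θW * r ^ k := by ring
  have htri : |(a (k + 1) - a k) * (1 : Matrix n n ℝ) z w - ((a (k + 1)) ^ 2 - (a k) ^ 2) * W (k + 1) z w
        - (a k) ^ 2 * (W (k + 1) z w - W k z w)|
      ≤ |(a (k + 1) - a k) * (1 : Matrix n n ℝ) z w| + |((a (k + 1)) ^ 2 - (a k) ^ 2) * W (k + 1) z w|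
        + |(a k) ^ 2 * (W (k + 1) z w - W k z w)| :=
    (abs_sub _ _).trans (add_le_add (abs_sub _ _) le_rfl)
  have e : (θa + 2 * abar * θa * CW + abar ^ 2 * θW) * r ^ k
      = θa * r ^ k + 2 * abar * θa * CW * r ^ k + abar ^ 2 * θW * r ^ k := by ring
  rw [e]
  linarith

end effective

/-! ## ADDENDUM v1.1 (append-only, same seat, 2026-08-20): §3b — the δ-function shape of [B5] (1.99)/(1.102)
(Bałaban's pure Yang–Mills transformations use δ(B − Q_kA), not King's Gaussian weight: `Δ_k = (Q_kGQ_k*)⁻¹ − a·I`,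
kernel cross-check `B5QGQ199Rate.qgqInv`), so that leaf (H3) descends to the BLOCK rate in Bałaban's own shape too. -/

/-! ## §3b One layer down, δ-function renormalization transformation: Bałaban's (1.99)/(1.102) shape
`Δ_k = (Q_kGQ_k*)⁻¹ − a·I` — (H3) ⇐ block rate ∧ k-uniform ℓ¹ bounds of the inverse blocks -/

section woodbury

variable (a : ℝ) (W : ℕ → Matrix n n ℝ)

/-- **Bałaban's δ-function shape** ([B5] p. 34, (1.102) «− ω = (QGQ*)⁻¹B» with (1.99)–(1.101); kernel
cross-check per fibre `B5QGQ199Rate.qgqInv`: `(QGQ*)⁻¹(p′) = a·I + D_k(p′)`, `D_k` = the (1.66) weight): on the unit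
lattice the effective operator is `(W_k)⁻¹ − a·I` with `W_k = Q_kG_kQ_k*` — the inverse-block counterpart of King's
(2.14) shape `effOp` (which belongs to the exponential-weight transformation of King / (Higgs)₂,₃). [folklore] -/
def effOpW (k : ℕ) : Matrix n n ℝ := (W k)⁻¹ - a • (1 : Matrix n n ℝ)

/-- the `a·I` part drops out of one-step differences. [folklore] -/
theorem effOpW_succ_sub (k : ℕ) :
    effOpW a W (k + 1) - effOpW a W k = (W (k + 1))⁻¹ - (W k)⁻¹ := by
  simp only [effOpW]
  abel

/-- **Entrywise resolvent bound**: for units `A`, `A′` with `ℓ¹` row sums of `A⁻¹` and `ℓ¹` column sums of `A′⁻¹`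
at most `R`, and `sup |A − A′| ≤ ε`: `|(A⁻¹ − A′⁻¹)(z,w)| ≤ R·R·ε`
(`A⁻¹ − A′⁻¹ = A⁻¹(A′ − A)A′⁻¹`, `King1986.inv_sub_inv_of_isUnit`). [folklore] -/
theorem abs_inv_sub_inv_apply_le (A A' : Matrix n n ℝ) (hA : IsUnit A) (hA' : IsUnit A') {R ε : ℝ}
    (hR : 0 ≤ R) (hrow : ∀ i, ∑ j, |A⁻¹ i j| ≤ R) (hcol : ∀ j, ∑ i, |A'⁻¹ i j| ≤ R)
    (hE : ∀ i j, |(A' - A) i j| ≤ ε) (z w : n) :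
    |(A⁻¹ - A'⁻¹) z w| ≤ R * R * ε := by
  have hε : 0 ≤ ε := (abs_nonneg _).trans (hE z w)
  rw [Literature.MathematicalPhysics.QuantumFieldTheory.King1986.inv_sub_inv_of_isUnit A A' hA hA']
  refine (Literature.MathematicalPhysics.QuantumFieldTheory.King1986.abs_mul_mul_apply_le _ _ _ z w).trans ?_
  calc ∑ u, ∑ v, |A⁻¹ z u| * |(A' - A) u v| * |A'⁻¹ v w|
      ≤ ∑ u, ∑ v, |A⁻¹ z u| * ε * |A'⁻¹ v w| := by
        refine Finset.sum_le_sum fun u _ => Finset.sum_le_sum fun v _ => ?_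
        exact mul_le_mul_of_nonneg_right (mul_le_mul_of_nonneg_left (hE u v) (abs_nonneg _)) (abs_nonneg _)
    _ = ε * ((∑ u, |A⁻¹ z u|) * (∑ v, |A'⁻¹ v w|)) := by
        rw [Finset.sum_mul_sum]
        rw [Finset.mul_sum]
        refine Finset.sum_congr rfl fun u _ => ?_
        rw [Finset.mul_sum]
        refine Finset.sum_congr rfl fun v _ => ?_
        ring
    _ ≤ ε * (R * R) := by
        refine mul_le_mul_of_nonneg_left ?_ hε
        exact mul_le_mul (hrow z) (hcol w) (Finset.sum_nonneg fun v _ => abs_nonneg _) hR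
    _ = R * R * ε := by ring

/-- **(H3) ONE LAYER DOWN, δ-function shape (kernel-checked).**  Units `W_k` with k-UNIFORM `ℓ¹` row and column
sums of the inverse blocks `(W_k)⁻¹` (`≤ R`; the printed KIND: exponential decay of the kernel of `(QGQ*)⁻¹`,
[B6] (2.149) p. 249 / [B9] (3.132) p. 422, η-uniform ⟹ `ℓ¹`) and a one-step SUP rate `θ_W r^k` of the blocks give
the sup rate `R²θ_W·r^k` of Bałaban-shaped effective operators.  Again the block rate is the only two-spacing input.
[folklore] -/
theorem effectiveOperatorSupRate_of_blockInv {θW R r : ℝ} (hR : 0 ≤ R) (hU : ∀ k, IsUnit (W k))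
    (hrow : ∀ k i, ∑ j, |(W k)⁻¹ i j| ≤ R) (hcol : ∀ k j, ∑ i, |(W k)⁻¹ i j| ≤ R)
    (hW : ∀ k z w, |(W (k + 1) - W k) z w| ≤ θW * r ^ k) :
    EffectiveOperatorSupRate (effOpW a W) (R * R * θW) r := by
  intro k z w
  rw [effOpW_succ_sub]
  have hE : ∀ i j, |(W k - W (k + 1)) i j| ≤ θW * r ^ k := fun i j => by
    rw [← neg_sub, Matrix.neg_apply, abs_neg]
    exact hW k i j
  have h := abs_inv_sub_inv_apply_le (W (k + 1)) (W k) (hU (k + 1)) (hU k) hR (hrow (k + 1)) (hcol k) hE z w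
  calc |((W (k + 1))⁻¹ - (W k)⁻¹) z w| ≤ R * R * (θW * r ^ k) := h
    _ = R * R * θW * r ^ k := by ring

end woodbury

end Summit.QuantumFields.BalabanUV.T4Continuum.NE2KingTransplant

end
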